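import Literature.Probability.RandomPlanarGeometry.HexParafermionLoop
import Literature.Probability.RandomPlanarGeometry.HexParafermionTransport
import HarnessLib

/-!
# Duminil-Copin–Smirnov 2012, Lemma 1: the vertex relation of the SAW parafermionic observable

Topic `Literature/Probability/RandomPlanarGeometry`; this file DISCHARGES the named fact
`Literature.Probability.RandomPlanarGeometry.SAW.DuminilCopinSmirnov2012_lemma1`
(`HexParafermion.lean`): **`DuminilCopinSmirnov2012_lemma1_holds`**. Source: H. Duminil-Copin,
S. Smirnov, *The connective constant of the honeycomb lattice equals `√(2+√2)`*, Ann. of Math.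
175 (2012), 1653–1665 (arXiv:1007.0575), §2, **Lemma 1**: "If `x = x_c` and `σ = 5/8`, then `F`
satisfies the following relation for every vertex `v ∈ V(Ω)`:
`(p - v)F(p) + (q - v)F(q) + (r - v)F(r) = 0`, where `p, q, r` are the mid-edges of the three
edges adjacent to `v`", for a simply connected domain `Ω` and `a ∈ ∂Ω`, and its proof (p. 4:
pairs and triplets of walks; "In order to evaluate the winding of `γ₁` between `p` and `q`
above, we used the fact that `a` is on the boundary and `Ω` is simply connected").

## Proof architecture

The combinatorial heart of DCS's proof (the partition of the walks ending at `p, q, r` into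
pairs — a path plus a loop traversed in the two directions, `j λ̄⁴ + j̄ λ⁴ = 0` — and triplets —
a walk and its two one-step prolongations, `1 + x_c j λ̄ + x_c j̄ λ = 0`) is
`HV.vertex_relation_of_wnd` (`HexParafermionLoop.lean`, after `HexSAWObservable.lean`), in the
coordinate model `HV` of the honeycomb lattice with the entrance mid-edge fixed at
`{wOut, hvOrigin}`, windings counted as `(π/3) · pturn`, under the hypotheses `wOut ∉ V` and
"every simple cycle of `V` has winding number `0` around the face `(1, 0)` at the entrance"
(the topological input, a discrete Umlaufsatz, is `HexSAWWinding.lean`). This file transports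
it to the statement of `HexParafermion.lean` (walks `HexMidEdgeSAW Λ a z` of `hexGraph` as
vertex lists, geometric windings `Literature.Probability.LatticeModels.winding` of the embedded
polyline, positions `hexMidpoint`, `hexCenter`):

* a chart `Φ : hexGraph ≃g hvGraph` taking the boundary mid-edge `a = {u, w₁}` (`u ∉ Λ ∋ w₁`)
  to the standard entrance and acting on the embedded lattice by a similarity `z ↦ α z + β`
  (`HV.exists_chart`, `HexParafermionTransport.lean`);
* simple connectivity of `Ω` ("connected complement", `hexDomainSimplyConnected`) makes the
  entrance lie outside every loop of `Φ(Λ)`: `HV.wnd_eq_zero_of_simplyConnected` (a lattice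
  path from `u` to a far vertex avoiding `Λ`, along which the winding number is constant);
* the coding `γ ↦ wOut :: Φ(γ.verts) ++ [Φ e]` (`e` the far end of the final mid-edge) is a
  bijection from the walks `a → {v, t}` onto the mid-edge walks of `Φ(Λ)` whose final dart lies
  on `{Φ v, Φ t}` (`HexMidEdgeSAW.isMidWalk_code`, `exists_code_eq`), and it is weight
  preserving (`HexMidEdgeSAW.weight_eq_pwt`: the geometric winding of a walk between mid-edges
  is `(π/3) · pturn` of its code — half-edges at the ends do not turn, similarities preserve
  turning angles, and lattice turns are `±π/3`, `HV.winding_map_emb_pos` — and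
  `e^{-i(5/8)W} = λ^{pturn}`), whence `hexParafermionicObservable_eq_sum_pwt`;
* the contribution `c(γ)` expands over the three mid-edges (`HV.cv_eq_three`), the directions
  `Φ(t) - Φ(v) = 2α (mid{v,t} - v)` scale by the similarity ratio, and `α ≠ 0`.

## Contents

* edge lists of vertex lists (`edges_cons_cons`, `forall_mem_of_mem_edges`, `mem_edges_iff`,
  `edges_nodup`, `exists_eq_last_pair_of_mem_edges`); windings of polylines
  (`winding_append_cons_cons`, `winding_concat₃`, `winding_map_affine`, `winding_cons_left_ray`,
  `winding_concat_right_ray`); `HV.prevOf_eq_getElem`, `HV.prevOf_eq_getElem_cons`;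
* the coding: `HexMidEdgeSAW.head_eq`, `.getLast_eq_or`, `.map_ne_prevOf`, `.isMidWalk_code`,
  `.finalDart_code`, `exists_code_eq`, `.winding_eq_winding_map`, `.weight_eq_pwt`,
  `hexParafermionicObservable_eq_sum_pwt`;
* `HV.eq_or_eq_or_eq_of_adj`, `HV.cv_eq_three`, `HV.leftFace_fst_of_adj`,
  `HV.wnd_eq_zero_of_simplyConnected`;
* **`DuminilCopinSmirnov2012_lemma1_holds : DuminilCopinSmirnov2012_lemma1`**.
-/

noncomputable section

open Finset Literature.Probability.LatticeModels Literature.Probability.Percolation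

namespace Literature.Probability.RandomPlanarGeometry.SAW




/-! ### Edge lists of vertex lists -/

section EdgeList

variable {V : Type*}

/-- The consecutive unordered pairs of `x :: y :: l`. [folklore] -/
theorem edges_cons_cons (x y : V) (l : List V) :
    List.zipWith (fun u w => s(u, w)) (x :: y :: l) (x :: y :: l).tail =
      s(x, y) :: List.zipWith (fun u w => s(u, w)) (y :: l) (y :: l).tail := rfl

/-- Every consecutive pair of a list consists of members of the list. [folklore] -/
theorem forall_mem_of_mem_edges : ∀ (l : List V) (e : Sym2 V),
    e ∈ List.zipWith (fun u w => s(u, w)) l l.tail → ∀ c ∈ e, c ∈ l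
  | [], e, he => by simp at he
  | [x], e, he => by simp at he
  | x :: y :: l, e, he => by
    rw [edges_cons_cons, List.mem_cons] at he
    intro c hc
    rcases he with rfl | he
    · rcases Sym2.mem_iff.1 hc with rfl | rfl <;> simp
    · exact List.mem_cons_of_mem _ (forall_mem_of_mem_edges (y :: l) e he c hc)

/-- Membership in the list of consecutive pairs, by indices. [folklore] -/
theorem mem_edges_iff {l : List V} {e : Sym2 V} :
    e ∈ List.zipWith (fun u w => s(u, w)) l l.tail ↔
      ∃ (i : ℕ) (h : i + 1 < l.length), e = s(l[i], l[i + 1]) := by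
  rw [List.mem_iff_getElem]
  constructor
  · rintro ⟨i, hi, rfl⟩
    rw [List.length_zipWith, List.length_tail] at hi
    refine ⟨i, by omega, ?_⟩
    rw [List.getElem_zipWith, List.getElem_tail]
  · rintro ⟨i, hi, rfl⟩
    refine ⟨i, by rw [List.length_zipWith, List.length_tail]; omega, ?_⟩
    rw [List.getElem_zipWith, List.getElem_tail]

/-- The consecutive pairs of a duplicate-free list are pairwise distinct. [folklore] -/
theorem edges_nodup : ∀ {l : List V}, l.Nodup →
    (List.zipWith (fun u w => s(u, w)) l l.tail).Nodup
  | [], _ => by simp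
  | [x], _ => by simp
  | x :: y :: l, h => by
    rw [edges_cons_cons, List.nodup_cons]
    refine ⟨fun hm => ?_, edges_nodup (List.nodup_cons.1 h).2⟩
    have hx : x ∈ y :: l := forall_mem_of_mem_edges _ _ hm x (Sym2.mem_mk_left x y)
    exact (List.nodup_cons.1 h).1 hx

end EdgeList

/-! ### Windings of polylines: additivity and affine invariance -/

section Winding

/-- **Additivity of the winding** at a common segment: the winding of `l₁ ++ [x, y] ++ l₂` is the
winding up to the segment `[x, y]` plus the winding from it. [folklore] -/
theorem winding_append_cons_cons : ∀ (l₁ : List ℂ) (x y : ℂ) (l₂ : List ℂ),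
    Literature.Probability.LatticeModels.winding (l₁ ++ x :: y :: l₂) =
      Literature.Probability.LatticeModels.winding (l₁ ++ [x, y]) +
        Literature.Probability.LatticeModels.winding (x :: y :: l₂)
  | [], x, y, l₂ => by simp
  | [z], x, y, l₂ => by simp
  | z :: z' :: l₁, x, y, l₂ => by
    have ih := winding_append_cons_cons (z' :: l₁) x y l₂
    rcases l₁ with _ | ⟨z'', l₁⟩
    · simp only [List.cons_append, List.nil_append, winding_cons_cons_cons] at ih ⊢
      rw [ih]; ring
    · simp only [List.cons_append, winding_cons_cons_cons] at ih ⊢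
      rw [ih]; ring

/-- Splitting off the last turning angle of a polyline. [folklore] -/
theorem winding_concat₃ (l : List ℂ) (x y w : ℂ) :
    Literature.Probability.LatticeModels.winding (l ++ [x, y, w]) =
      Literature.Probability.LatticeModels.winding (l ++ [x, y]) + turning x y w := by
  rw [show l ++ [x, y, w] = l ++ x :: y :: [w] from rfl, winding_append_cons_cons]
  simp

/-- The winding of a polyline is invariant under complex-affine maps `z ↦ κ z + μ`, `κ ≠ 0`
(in particular it is scale invariant). [folklore] -/
theorem winding_map_affine {κ : ℂ} (hκ : κ ≠ 0) (μ : ℂ) : ∀ (l : List ℂ),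
    Literature.Probability.LatticeModels.winding (l.map fun z => κ * z + μ) =
      Literature.Probability.LatticeModels.winding l
  | [] => by simp
  | [_] => by simp
  | [_, _] => by simp
  | a :: b :: c :: l => by
    have ih := winding_map_affine hκ μ (b :: c :: l)
    simp only [List.map_cons] at ih ⊢
    rw [winding_cons_cons_cons, winding_cons_cons_cons, ih, HV.turning_affine hκ]

end Winding


/-! ### Last consecutive pair; the vertex before the last -/

section LastPair

variable {V : Type*}

/-- In a duplicate-free list, a consecutive pair containing the last entry is the last
consecutive pair. [folklore] -/
theorem exists_eq_last_pair_of_mem_edges {l : List V} (hl : l.Nodup) (hne : l ≠ []) {c d : V}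
    (h : s(c, d) ∈ List.zipWith (fun u w => s(u, w)) l l.tail) (hc : l.getLast hne ∈ s(c, d)) :
    ∃ (i : ℕ) (hi : i + 1 < l.length), i + 2 = l.length ∧ s(c, d) = s(l[i], l[i + 1]) := by
  obtain ⟨i, hi, he⟩ := mem_edges_iff.1 h
  refine ⟨i, hi, ?_, he⟩
  rw [he, List.getLast_eq_getElem] at hc
  rcases Sym2.mem_iff.1 hc with h1 | h1
  · have := (hl.getElem_inj_iff).1 h1; omega
  · have := (hl.getElem_inj_iff).1 h1; omega

/-- The last consecutive pair of a list with at least two entries. [folklore] -/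
theorem last_pair_mem_edges {l : List V} {i : ℕ} (hi : i + 1 < l.length) (h2 : i + 2 = l.length) :
    s(l[i], l[i + 1]) ∈ List.zipWith (fun u w => s(u, w)) l l.tail :=
  mem_edges_iff.2 ⟨i, hi, rfl⟩

end LastPair

namespace HV

/-- The vertex before the last of a one-vertex inner list is the outer vertex `wOut`.
[folklore] -/
@[simp] theorem prevOf_singleton (x : HV) : prevOf [x] = wOut := rfl

/-- The vertex before the last of an inner list with at least two entries. [folklore] -/
theorem prevOf_eq_getElem {m : List HV} {i : ℕ} (hi : i + 1 < m.length) (h2 : i + 2 = m.length) :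
    prevOf m = m[i]'(Nat.lt_of_succ_lt hi) := by
  have hd : m.dropLast ≠ [] := by
    intro h; have := congrArg List.length h; rw [List.length_dropLast] at this; simp at this; omega
  rw [prevOf, List.getLast_cons hd, List.getLast_eq_getElem, List.getElem_dropLast]
  congr 1
  rw [List.length_dropLast]; omega

/-- `prevOf m` as an entry of `wOut :: m`: the one two places before the end of `wOut :: m ++ [u]`.
[folklore] -/
theorem prevOf_eq_getElem_cons {m : List HV} (hm : m ≠ []) {i : ℕ} (hi : i < (wOut :: m).length)
    (h2 : i + 1 = m.length) : prevOf m = (wOut :: m)[i] := by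
  rcases i with _ | i
  · obtain ⟨x, _ | ⟨y, r⟩, rfl⟩ : ∃ x r, m = x :: r := List.exists_cons_of_ne_nil hm
    · rfl
    · simp at h2
  · rw [List.getElem_cons_succ]
    exact prevOf_eq_getElem (by simp at hi; omega) (by omega)

end HV

/-! ### Coding mid-edge walks of `hexGraph` by coordinate lists -/

section Code

open HV

variable {Λ : Finset HexVertex} {a : Sym2 HexVertex} {u w₁ v t : HexVertex}
  {Φ : hexGraph ≃g hvGraph}

/-- A walk from the boundary mid-edge `a = {u, w₁}`, `u ∉ Λ`, starts at `w₁`. [folklore] -/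
theorem HexMidEdgeSAW.head_eq {z : Sym2 HexVertex} (γ : HexMidEdgeSAW Λ a z) (ha : a = s(u, w₁))
    (hu : u ∉ Λ) (hne : γ.verts ≠ []) : γ.verts.head hne = w₁ := by
  subst ha
  have h := γ.head_mem (γ.verts.head hne) (List.head?_eq_some_head hne)
  rw [Sym2.mem_iff] at h
  rcases h with h | h
  · exact absurd (h ▸ γ.subset _ (List.head_mem hne)) hu
  · exact h

/-- The last vertex of a walk to the mid-edge `{v, t}` is `v` or `t`. [folklore] -/
theorem HexMidEdgeSAW.getLast_eq_or (γ : HexMidEdgeSAW Λ a s(v, t)) (hne : γ.verts ≠ []) :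
    γ.verts.getLast hne = v ∨ γ.verts.getLast hne = t :=
  Sym2.mem_iff.1 (γ.getLast_mem _ (List.getLast?_eq_some_getLast hne))

/-- **No U-turn on the final mid-edge**: the far end `e` of the final mid-edge `{last, e} = {v, t}`
differs from the vertex visited before the last (from the outer vertex `u` if only one vertex
is visited) — in the code, `Φ e ≠ prevOf`. [cite: DuminilCopinSmirnov2012, §1–§2 (walks between
mid-edges)] -/
theorem HexMidEdgeSAW.map_ne_prevOf (γ : HexMidEdgeSAW Λ a s(v, t)) (ha : a = s(u, w₁))
    (hu : u ∉ Λ) (hΦu : Φ u = wOut) (hne : γ.verts ≠ []) {e : HexVertex}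
    (he : (γ.verts.getLast hne = v ∧ e = t) ∨ (γ.verts.getLast hne = t ∧ e = v)) :
    Φ e ≠ prevOf (γ.verts.map Φ) := by
  have hnd := γ.edges_nodup hne
  have hz : s(v, t) = s(γ.verts.getLast hne, e) := by
    rcases he with ⟨h1, rfl⟩ | ⟨h1, rfl⟩
    · rw [h1]
    · rw [h1, Sym2.eq_swap]
  -- `s(v, t)` is not among the consecutive pairs, and differs from `a`
  rw [List.nodup_append] at hnd
  obtain ⟨-, -, hdis⟩ := hnd
  have ha' : a ≠ s(v, t) := hdis a List.mem_cons_self _ (List.mem_singleton_self _)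
  rcases Nat.lt_or_ge 1 γ.verts.length with h2 | h1
  · -- at least two vertices: `e` is not the vertex before the last
    obtain ⟨i, hi, hi2⟩ : ∃ i, i + 1 < γ.verts.length ∧ i + 2 = γ.verts.length :=
      ⟨γ.verts.length - 2, by omega, by omega⟩
    have hp : prevOf (γ.verts.map Φ) = Φ (γ.verts[i]) := by
      rw [prevOf_eq_getElem (m := γ.verts.map Φ) (i := i) (by simpa using hi) (by simpa using hi2),
        List.getElem_map]
    rw [hp, Ne, Φ.injective.eq_iff]
    intro hei
    have hmem := last_pair_mem_edges (l := γ.verts) hi hi2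
    have hlast : γ.verts[i + 1] = γ.verts.getLast hne := by
      rw [List.getLast_eq_getElem]; congr 1; omega
    have hz' : s(v, t) = s(γ.verts[i], γ.verts.getLast hne) :=
      hz.trans (by rw [hei]; exact Sym2.eq_swap)
    rw [hlast, ← hz'] at hmem
    exact hdis _ (List.mem_cons_of_mem _ hmem) _ (List.mem_singleton_self _) rfl
  · -- exactly one vertex `w₁`: `e ≠ u` since `{w₁, e} = {v, t} ≠ a = {u, w₁}`
    obtain ⟨x, r, hx⟩ := List.exists_cons_of_ne_nil hne
    have hr : r = [] := by
      have : (x :: r).length ≤ 1 := hx ▸ h1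
      simpa using this
    subst hr
    have hx₁ : x = w₁ := by
      have := γ.head_eq ha hu hne; simp [hx] at this; exact this
    have hlast : γ.verts.getLast hne = w₁ := by simp [hx, hx₁]
    simp only [hx, List.map_cons, List.map_nil, prevOf_singleton, ← hΦu, Ne, Φ.injective.eq_iff]
    intro heu
    apply ha'
    rw [ha, hz, hlast, heu]
    exact Sym2.eq_swap

variable (Φ) in
/-- **The code of a nontrivial walk is a mid-edge walk of the coordinate model**: for a walk
`γ` from the boundary mid-edge `a = {u, w₁}` (`u ∉ Λ`) to `{v, t}` with vertex list
`l ≠ []`, the list `wOut :: Φ(l) ++ [Φ e]` (with `{last, e} = {v, t}`) is a self-avoiding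
mid-edge walk from `{wOut, hvOrigin}` in `Φ(Λ)`. [cite: DuminilCopinSmirnov2012, §1–§2 (walks
between mid-edges)] -/
theorem HexMidEdgeSAW.isMidWalk_code (γ : HexMidEdgeSAW Λ a s(v, t)) (ha : a = s(u, w₁))
    (hu : u ∉ Λ) (hΦu : Φ u = wOut) (hΦw : Φ w₁ = hvOrigin) (hvt : hexGraph.Adj v t)
    (hne : γ.verts ≠ []) {e : HexVertex}
    (he : (γ.verts.getLast hne = v ∧ e = t) ∨ (γ.verts.getLast hne = t ∧ e = v)) :
    IsMidWalk (Λ.map Φ.toEquiv.toEmbedding) (wOut :: (γ.verts.map Φ ++ [Φ e])) := by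
  have hne' : γ.verts.map Φ ≠ [] := by simpa using hne
  refine (isMidWalk_cons_append_iff _ hne' (Φ e)).2 ⟨?_, ?_, ?_, ?_, ?_, ?_⟩
  · rw [List.isChain_map]
    exact List.IsChain.imp (fun x y h => (Φ.map_rel_iff).2 h) γ.isChain
  · rw [List.head?_map, List.head?_eq_some_head hne, Option.map_some, γ.head_eq ha hu hne, hΦw]
  · rw [List.getLast_map hne']
    refine (Φ.map_rel_iff).2 ?_
    rcases he with ⟨h1, rfl⟩ | ⟨h1, rfl⟩
    · rw [h1]; exact hvt
    · rw [h1]; exact hvt.symm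
  · intro x hx
    obtain ⟨y, hy, rfl⟩ := List.mem_map.1 hx
    exact Finset.mem_map.2 ⟨y, γ.subset y hy, rfl⟩
  · exact γ.nodup.map Φ.injective
  · exact γ.map_ne_prevOf ha hu hΦu hne he

/-- The final dart of the code of a nontrivial walk to `{v, t}` is `(Φ v, Φ t)` or `(Φ t, Φ v)`.
[folklore] -/
theorem HexMidEdgeSAW.finalDart_code (γ : HexMidEdgeSAW Λ a s(v, t)) (hne : γ.verts ≠ [])
    {e : HexVertex}
    (he : (γ.verts.getLast hne = v ∧ e = t) ∨ (γ.verts.getLast hne = t ∧ e = v)) :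
    finalDart (wOut :: (γ.verts.map Φ ++ [Φ e])) = (Φ v, Φ t) ∨
      finalDart (wOut :: (γ.verts.map Φ ++ [Φ e])) = (Φ t, Φ v) := by
  have hne' : γ.verts.map Φ ≠ [] := by simpa using hne
  rw [finalDart_cons_append hne', List.getLast_map hne']
  rcases he with ⟨h1, rfl⟩ | ⟨h1, rfl⟩
  · left; rw [h1]
  · right; rw [h1]


/-- In a duplicate-free nonempty list whose head is also its last entry, there is only one entry.
[folklore] -/
theorem length_eq_one_of_head_eq_getLast {V : Type*} {m : List V} (hm : m ≠ []) (hnd : m.Nodup)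
    (h : m.head hm = m.getLast hm) : m.length = 1 := by
  obtain ⟨x, r, rfl⟩ := List.exists_cons_of_ne_nil hm
  rcases eq_or_ne r [] with rfl | hr
  · rfl
  · rw [List.head_cons, List.getLast_cons hr] at h
    exact absurd (h ▸ List.getLast_mem hr) (List.nodup_cons.1 hnd).1

/-- **Decoding**: every nontrivial mid-edge walk of the coordinate model in `Φ(Λ)` whose final
dart lies on the edge `{Φ v, Φ t}` is the code of a (unique) nontrivial self-avoiding walk of
`hexGraph` from `a = {u, w₁}` to the mid-edge `{v, t}`. [cite: DuminilCopinSmirnov2012, §1–§2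
(walks between mid-edges)] -/
theorem exists_code_eq (ha : a = s(u, w₁)) (hu : u ∉ Λ) (hw₁ : w₁ ∈ Λ)
    (huw : hexGraph.Adj u w₁) (hΦu : Φ u = wOut) (hΦw : Φ w₁ = hvOrigin)
    (hvt : hexGraph.Adj v t) (hv : v ∈ Λ) {P : List HV}
    (hP : IsMidWalk (Λ.map Φ.toEquiv.toEmbedding) P) (hP0 : P ≠ [wOut, hvOrigin])
    (hfd : finalDart P = (Φ v, Φ t) ∨ finalDart P = (Φ t, Φ v)) :
    ∃ (γ : HexMidEdgeSAW Λ a s(v, t)) (hne : γ.verts ≠ []) (e : HexVertex),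
      ((γ.verts.getLast hne = v ∧ e = t) ∨ (γ.verts.getLast hne = t ∧ e = v)) ∧
        P = wOut :: (γ.verts.map Φ ++ [Φ e]) := by
  rcases hP.trivial_or_exists with rfl | ⟨m, e', hm, rfl⟩
  · exact absurd rfl hP0
  obtain ⟨hc, hh, hadj, hV, hnd, hne'⟩ := (isMidWalk_cons_append_iff _ hm e').1 hP
  have hw : wOut ∉ Λ.map Φ.toEquiv.toEmbedding := by
    intro h
    obtain ⟨y, hy, hyu⟩ := Finset.mem_map.1 h
    change Φ y = wOut at hyu
    exact hu (Φ.injective (hyu.trans hΦu.symm) ▸ hy)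
  set l : List HexVertex := m.map Φ.symm with hl_def
  have hlm : l.map Φ = m := by simp [hl_def, List.map_map, Function.comp_def]
  have hl : l ≠ [] := by simpa [hl_def] using hm
  have hsub : ∀ x ∈ l, x ∈ Λ := by
    intro x hx
    obtain ⟨y, hy, rfl⟩ := List.mem_map.1 hx
    exact Finset.mem_map_equiv.1 (hV y hy)
  have hnodup : l.Nodup := hnd.map Φ.symm.injective
  have hchain : l.IsChain hexGraph.Adj := by
    rw [hl_def, List.isChain_map]
    exact List.IsChain.imp (fun x y h => (Φ.symm.map_rel_iff).2 h) hc
  have hhead : l.head hl = w₁ := by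
    have h1 : m.head hm = hvOrigin := by
      rw [List.head?_eq_some_head hm, Option.some_inj] at hh; exact hh
    rw [show l.head hl = Φ.symm (m.head hm) by simp [hl_def], h1, ← hΦw, RelIso.symm_apply_apply]
  have hlast : l.getLast hl = Φ.symm (m.getLast hm) := by simp [hl_def, List.getLast_map]
  simp only [finalDart_cons_append hm, Prod.mk.injEq] at hfd
  -- the far end of the final mid-edge and the last vertex
  set e : HexVertex := Φ.symm e' with he_def
  have hee : Φ e = e' := RelIso.apply_symm_apply Φ e'
  have he : (l.getLast hl = v ∧ e = t) ∨ (l.getLast hl = t ∧ e = v) := by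
    rcases hfd with ⟨h1, h2⟩ | ⟨h1, h2⟩
    · left; rw [hlast, h1, he_def, h2, RelIso.symm_apply_apply, RelIso.symm_apply_apply]
      exact ⟨rfl, rfl⟩
    · right; rw [hlast, h1, he_def, h2, RelIso.symm_apply_apply, RelIso.symm_apply_apply]
      exact ⟨rfl, rfl⟩
  have hlast_mem : l.getLast hl ∈ s(v, t) := by
    rcases he with ⟨h1, -⟩ | ⟨h1, -⟩
    · rw [h1]; exact Sym2.mem_mk_left v t
    · rw [h1]; exact Sym2.mem_mk_right v t
  -- no U-turn: `s(v, t)` differs from `a` and from every consecutive pair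
  have hdis : ∀ x ∈ a :: List.zipWith (fun u w => s(u, w)) l l.tail, ∀ y ∈ [s(v, t)], x ≠ y := by
    intro x hx y hy
    rw [List.mem_singleton] at hy
    subst hy
    rcases List.mem_cons.1 hx with rfl | hx
    · -- `a = s(v, t)` forces `u = t`, `w₁ = v`, and then the walk is `[w₁]` exiting through `u`
      intro h
      rw [ha, Sym2.eq_iff] at h
      rcases h with ⟨rfl, rfl⟩ | ⟨rfl, rfl⟩
      · exact hu hv
      · -- `u = t`, `w₁ = v`
        rcases hfd with ⟨h1, h2⟩ | ⟨h1, -⟩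
        · rw [hΦw] at h1
          have hlen : m.length = 1 := length_eq_one_of_head_eq_getLast hm hnd (by
            rw [h1]; rw [List.head?_eq_some_head hm, Option.some_inj] at hh; exact hh)
          obtain ⟨x, r, rfl⟩ := List.exists_cons_of_ne_nil hm
          have hr : r = [] := by simpa using hlen
          subst hr
          rw [prevOf_singleton, h2, hΦu] at hne'
          exact hne' rfl
        · rw [hΦu] at h1
          exact hw (h1 ▸ hV _ (List.getLast_mem hm))
    · -- `s(v, t)` a consecutive pair: then `e` is the vertex before the last
      intro h
      rw [h] at hx
      obtain ⟨i, hi, hi2, heq⟩ := exists_eq_last_pair_of_mem_edges hnodup hl hx hlast_mem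
      have hli : l[i + 1] = l.getLast hl := by
        rw [List.getLast_eq_getElem]; congr 1; omega
      have hei : e = l[i] := by
        rw [hli, Sym2.eq_iff] at heq
        rcases he with ⟨h1, h2⟩ | ⟨h1, h2⟩
        · rw [h1] at heq
          rcases heq with ⟨-, h4⟩ | ⟨-, h4⟩
          · exact absurd h4 hvt.ne.symm
          · exact h2.trans h4
        · rw [h1] at heq
          rcases heq with ⟨h3, -⟩ | ⟨h3, -⟩
          · exact h2.trans h3
          · exact absurd h3 hvt.ne
      apply hne'
      rw [← hee, hei, prevOf_eq_getElem (m := m) (i := i) (by rw [← hlm]; simpa using hi)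
        (by rw [← hlm]; simpa using hi2)]
      simp [← hlm]
  refine ⟨⟨l, hsub, hnodup, hchain, fun x hx => ?_, fun x hx => ?_, fun h => absurd h hl,
    fun _ => ?_, ?_⟩, hl, e, he, by rw [hlm, hee]⟩
  · rw [List.head?_eq_some_head hl, Option.some_inj] at hx
    rw [← hx, hhead, ha]; exact Sym2.mem_mk_right u w₁
  · rw [List.getLast?_eq_some_getLast hl, Option.some_inj] at hx
    rw [← hx]; exact hlast_mem
  · refine List.nodup_append.2 ⟨List.nodup_cons.2 ⟨fun h => hu ?_, edges_nodup hnodup⟩,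
      List.nodup_singleton _, hdis⟩
    exact hsub u (forall_mem_of_mem_edges l a h u (by rw [ha]; exact Sym2.mem_mk_left u w₁))
  · refine ⟨?_, w₁, by rw [ha]; exact Sym2.mem_mk_right u w₁, hw₁⟩
    rw [ha]; exact (SimpleGraph.mem_edgeSet hexGraph).2 huw

end Code

/-! ### The weight of a walk is the parafermionic weight of its code -/

section Weight

open HV

/-- Moving the first point of a polyline along its first segment does not change the winding.
[folklore] -/
theorem winding_cons_left_ray {t : ℝ} (ht : 0 < t) (p q : ℂ) (L : List ℂ) :
    Literature.Probability.LatticeModels.winding ((q + t * (p - q)) :: q :: L) =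
      Literature.Probability.LatticeModels.winding (p :: q :: L) := by
  cases L with
  | nil => simp
  | cons r L => rw [winding_cons_cons_cons, winding_cons_cons_cons, turning_left_ray ht]

/-- Moving the last point of a polyline along its last segment does not change the winding.
[folklore] -/
theorem winding_concat_right_ray {t : ℝ} (ht : 0 < t) (L : List ℂ) (q p : ℂ) :
    Literature.Probability.LatticeModels.winding (L ++ [q, q + t * (p - q)]) =
      Literature.Probability.LatticeModels.winding (L ++ [q, p]) := by
  rcases L.eq_nil_or_concat' with rfl | ⟨L, r, rfl⟩
  · simp
  · simp only [List.append_assoc, List.cons_append, List.nil_append]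
    rw [winding_concat₃, winding_concat₃, turning_right_ray ht]

variable {Λ : Finset HexVertex} {a : Sym2 HexVertex} {u w₁ v t : HexVertex}
  {Φ : hexGraph ≃g hvGraph} {α β : ℂ}

/-- **The winding of a walk between mid-edges is the winding of the lattice path through the
far ends of its two mid-edges**: the first and last half-segments are halves of the edges `a`
and `{last, e}`. [cite: DuminilCopinSmirnov2012, §2 (winding)] -/
theorem HexMidEdgeSAW.winding_eq_winding_map (γ : HexMidEdgeSAW Λ a s(v, t)) (ha : a = s(u, w₁))
    (hu : u ∉ Λ) (hne : γ.verts ≠ []) {e : HexVertex}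
    (he : (γ.verts.getLast hne = v ∧ e = t) ∨ (γ.verts.getLast hne = t ∧ e = v)) :
    γ.winding = Literature.Probability.LatticeModels.winding ((u :: (γ.verts ++ [e])).map hexCenter) := by
  have hhead := γ.head_eq ha hu hne
  obtain ⟨x, rest, hx⟩ := List.exists_cons_of_ne_nil hne
  have hx₁ : x = w₁ := by rw [← hhead]; simp [hx]
  rw [hx₁] at hx
  obtain ⟨L₀, g, hLg⟩ : ∃ L₀ g, γ.verts = L₀ ++ [g] :=
    ⟨_, _, (List.dropLast_append_getLast hne).symm⟩
  have hg : γ.verts.getLast hne = g := by simp [hLg]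
  rw [hg] at he
  have hz : hexMidpoint s(v, t) = hexCenter g + (1 / 2 : ℝ) * (hexCenter e - hexCenter g) := by
    have : hexMidpoint s(v, t) = (hexCenter g + hexCenter e) / 2 := by
      rcases he with ⟨h1, rfl⟩ | ⟨h1, rfl⟩
      · rw [← h1, hexMidpoint_mk]
      · rw [← h1, hexMidpoint_mk, add_comm]
    rw [this]; push_cast; ring
  have ha' : hexMidpoint a = hexCenter w₁ + (1 / 2 : ℝ) * (hexCenter u - hexCenter w₁) := by
    rw [ha, hexMidpoint_mk]; push_cast; ring
  -- step 1: move the first point from `mid(a)` to `c u`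
  have h1 : γ.winding = Literature.Probability.LatticeModels.winding
      ((hexCenter u :: γ.verts.map hexCenter) ++ [hexMidpoint s(v, t)]) := by
    rw [HexMidEdgeSAW.winding, HexMidEdgeSAW.points, ha', hx]
    simp only [List.map_cons, List.cons_append]
    exact winding_cons_left_ray (t := 1 / 2) (by norm_num) _ _ _
  -- step 2: move the last point from `mid {v, t}` to `c e`
  rw [h1, hz, hLg]
  have h2 := winding_concat_right_ray (t := 1 / 2) (by norm_num) (hexCenter u :: L₀.map hexCenter)
    (hexCenter g) (hexCenter e)
  simp only [List.map_append, List.map_cons, List.map_nil, List.cons_append, List.append_assoc,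
    List.nil_append] at h2 ⊢
  exact h2

/-- **The weight of a nontrivial walk at `x = x_c`, `σ = 5/8` is the parafermionic weight
`x_c^ℓ λ^{pturn}` of its code**: the geometric winding is `(π/3) · pturn` (the chart is a
similarity, and turns of the honeycomb lattice are `±π/3`), and `e^{-i(5/8)(π/3)k} = λ^k`.
[cite: DuminilCopinSmirnov2012, §2 (Definition 1 and "λ = exp(-i5π/24)")] -/
theorem HexMidEdgeSAW.weight_eq_pwt (γ : HexMidEdgeSAW Λ a s(v, t)) (ha : a = s(u, w₁))
    (hu : u ∉ Λ) (hΦu : Φ u = wOut) (hΦw : Φ w₁ = hvOrigin) (hvt : hexGraph.Adj v t)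
    (haff : ∀ f, emb (pos (Φ f)) = α * hexCenter f + β) (hα : α ≠ 0)
    (hne : γ.verts ≠ []) {e : HexVertex}
    (he : (γ.verts.getLast hne = v ∧ e = t) ∨ (γ.verts.getLast hne = t ∧ e = v)) :
    γ.weight hexCriticalFugacity (5 / 8) = pwt (wOut :: (γ.verts.map Φ ++ [Φ e])) := by
  have hmw := γ.isMidWalk_code Φ ha hu hΦu hΦw hvt hne he
  set m := γ.verts.map Φ with hm
  have hmne : m ≠ [] := by simpa [hm] using hne
  -- the code as the image of the lattice path `u :: verts ++ [e]`
  have hcode : wOut :: (m ++ [Φ e]) = (u :: (γ.verts ++ [e])).map Φ := by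
    simp [hm, hΦu]
  -- (1) geometric winding = winding of the embedded code (affine invariance)
  have hc : ∀ f, hexCenter f = α⁻¹ * emb (pos (Φ f)) + -(β / α) := by
    intro f; rw [haff]; field_simp; ring
  have hW : γ.winding = (Real.pi / 3) * pturn (wOut :: (m ++ [Φ e])) := by
    rw [γ.winding_eq_winding_map ha hu hne he]
    have e1 : (u :: (γ.verts ++ [e])).map hexCenter =
        (((u :: (γ.verts ++ [e])).map Φ).map fun y => emb (pos y)).map
          fun z => α⁻¹ * z + -(β / α) := by
      simp only [List.map_map]
      exact List.map_congr_left fun f _ => hc f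
    rw [e1, winding_map_affine (inv_ne_zero hα), ← hcode]
    refine winding_map_emb_pos _ hmw.1 ?_
    -- no backtracking in the code
    have hQ : (wOut :: m).Nodup := by
      refine List.nodup_cons.2 ⟨fun h => hu ?_, γ.nodup.map Φ.injective⟩
      rw [hm, ← hΦu, List.mem_map] at h
      obtain ⟨y, hy, hyu⟩ := h
      exact Φ.injective hyu ▸ γ.subset y hy
    have hnb : ∀ (i : ℕ) (hi : i + 2 < ((wOut :: m) ++ [Φ e]).length),
        ((wOut :: m) ++ [Φ e])[i] ≠ ((wOut :: m) ++ [Φ e])[i + 2] := by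
      intro i hi
      by_cases h2 : i + 2 < (wOut :: m).length
      · rw [List.getElem_append_left (by omega), List.getElem_append_left h2]
        intro h
        have := (hQ.getElem_inj_iff).1 h
        omega
      · have hlen : i + 2 = (wOut :: m).length := by
          simp only [List.length_append, List.length_singleton] at hi
          omega
        rw [List.getElem_append_left (by omega), List.getElem_concat_length hlen,
          ← prevOf_eq_getElem_cons hmne (by omega) (by simp at hlen; omega)]
        exact (γ.map_ne_prevOf ha hu hΦu hne he).symm
    exact hnb
  -- (2) the weight
  rw [HexMidEdgeSAW.weight, pwt, mwLen_cons_append, hW, lam_zpow, HexMidEdgeSAW.length, hm,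
    List.length_map, mul_comm]
  congr 1
  congr 1
  push_cast
  simp only [θ₅]
  push_cast
  ring

end Weight


/-! ### The observable as a sum over coded walks -/

section Observable

open HV

variable {Λ : Finset HexVertex} {a : Sym2 HexVertex} {u w₁ v t : HexVertex}
  {Φ : hexGraph ≃g hvGraph} {α β : ℂ}

/-- The far end of the final mid-edge `{v, t}`, computed from the last vertex. [folklore] -/
theorem HexMidEdgeSAW.ite_spec (γ : HexMidEdgeSAW Λ a s(v, t)) (hvt : hexGraph.Adj v t)
    (hne : γ.verts ≠ []) :
    (γ.verts.getLast hne = v ∧ (if γ.verts.getLast hne = v then t else v) = t) ∨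
      (γ.verts.getLast hne = t ∧ (if γ.verts.getLast hne = v then t else v) = v) := by
  rcases γ.getLast_eq_or hne with h1 | h1
  · exact Or.inl ⟨h1, if_pos h1⟩
  · refine Or.inr ⟨h1, if_neg ?_⟩
    rw [h1]; exact hvt.ne.symm

/-- **`F(z)` as a sum over the coordinate model**: for a boundary mid-edge `a = {u, w₁}`
(`u ∉ Λ ∋ w₁`) mapped to the standard entrance by the chart `Φ`, the parafermionic observable at
the mid-edge `{v, t}` (`v ∈ Λ`) at `x = x_c`, `σ = 5/8` is the sum of the parafermionic weights
`x_c^ℓ λ^{pturn}` of the mid-edge walks of `Φ(Λ)` whose final dart lies on `{Φ v, Φ t}` — the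
coding `γ ↦ wOut :: Φ(γ) ++ [Φ e]` is a weight-preserving bijection.
[cite: DuminilCopinSmirnov2012, Definition 1] -/
theorem hexParafermionicObservable_eq_sum_pwt (ha : a = s(u, w₁)) (hu : u ∉ Λ) (hw₁ : w₁ ∈ Λ)
    (huw : hexGraph.Adj u w₁) (hΦu : Φ u = wOut) (hΦw : Φ w₁ = hvOrigin)
    (haff : ∀ f, emb (pos (Φ f)) = α * hexCenter f + β) (hα : α ≠ 0)
    (hvt : hexGraph.Adj v t) (hv : v ∈ Λ) :
    hexParafermionicObservable Λ a hexCriticalFugacity (5 / 8) s(v, t) =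
      ∑ P ∈ (midWalks (Λ.map Φ.toEquiv.toEmbedding)).filter
          (fun P => finalDart P = (Φ v, Φ t) ∨ finalDart P = (Φ t, Φ v)), pwt P := by
  classical
  rw [hexParafermionicObservable]
  refine Finset.sum_bij (fun γ _ => if h : γ.verts = [] then [wOut, hvOrigin]
      else wOut :: (γ.verts.map Φ ++ [Φ (if γ.verts.getLast h = v then t else v)]))
    (fun γ _ => ?_) (fun γ₁ _ γ₂ _ h => ?_) (fun P hP => ?_) (fun γ _ => ?_)
  · -- the code is a walk with the right final dart
    by_cases h : γ.verts = []
    · rw [dif_pos h, Finset.mem_filter, mem_midWalks_iff]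
      refine ⟨isMidWalk_trivial _, ?_⟩
      rw [finalDart_trivial, ← hΦu, ← hΦw]
      have haz : s(u, w₁) = s(v, t) := ha ▸ γ.eq_of_nil h
      rcases Sym2.eq_iff.1 haz with ⟨h1, h2⟩ | ⟨h1, h2⟩
      · left; rw [h1, h2]
      · right; rw [h1, h2]
    · rw [dif_neg h, Finset.mem_filter, mem_midWalks_iff]
      exact ⟨γ.isMidWalk_code Φ ha hu hΦu hΦw hvt h (γ.ite_spec hvt h),
        γ.finalDart_code h (γ.ite_spec hvt h)⟩
  · -- injectivity
    apply HexMidEdgeSAW.ext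
    by_cases h₁ : γ₁.verts = [] <;> by_cases h₂ : γ₂.verts = []
    · rw [h₁, h₂]
    · rw [dif_pos h₁, dif_neg h₂] at h
      have := congrArg List.length h
      simp only [List.length_cons, List.length_append, List.length_map, List.length_nil] at this
      exact absurd (List.eq_nil_of_length_eq_zero (by omega)) h₂
    · rw [dif_neg h₁, dif_pos h₂] at h
      have := congrArg List.length h
      simp only [List.length_cons, List.length_append, List.length_map, List.length_nil] at this
      exact absurd (List.eq_nil_of_length_eq_zero (by omega)) h₁
    · rw [dif_neg h₁, dif_neg h₂] at h
      have h' := congrArg List.dropLast (List.cons.inj h).2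
      rw [List.dropLast_concat, List.dropLast_concat] at h'
      exact List.map_injective_iff.2 Φ.injective h'
  · -- surjectivity
    rw [Finset.mem_filter, mem_midWalks_iff] at hP
    obtain ⟨hPm, hfd⟩ := hP
    by_cases hP0 : P = [wOut, hvOrigin]
    · subst hP0
      have haz : a = s(v, t) := by
        rw [finalDart_trivial] at hfd
        simp only [← hΦu, ← hΦw, Prod.mk.injEq, EmbeddingLike.apply_eq_iff_eq] at hfd
        rw [ha]
        rcases hfd with ⟨h1, h2⟩ | ⟨h1, h2⟩
        · rw [h1, h2]
        · rw [h1, h2, Sym2.eq_swap]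
      have hfst : a ∈ hexDomainMidEdges Λ := by
        refine ⟨?_, w₁, by rw [ha]; exact Sym2.mem_mk_right u w₁, hw₁⟩
        rw [ha]; exact (SimpleGraph.mem_edgeSet hexGraph).2 huw
      refine ⟨⟨[], by simp, List.nodup_nil, List.isChain_nil, by simp, by simp, fun _ => haz,
        fun h => (h rfl).elim, hfst⟩, Finset.mem_univ _, ?_⟩
      rw [dif_pos rfl]
    · obtain ⟨γ, hne, e, he, rfl⟩ :=
        exists_code_eq ha hu hw₁ huw hΦu hΦw hvt hv hPm hP0 hfd
      refine ⟨γ, Finset.mem_univ _, ?_⟩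
      rw [dif_neg hne]
      congr 3
      rcases he with ⟨h1, h2⟩ | ⟨h1, h2⟩
      · rw [if_pos h1, h2]
      · rw [if_neg (by rw [h1]; exact hvt.ne.symm), h2]
  · -- the weights agree
    by_cases h : γ.verts = []
    · rw [dif_pos h]
      simp [HexMidEdgeSAW.weight, HexMidEdgeSAW.winding, HexMidEdgeSAW.points,
        HexMidEdgeSAW.length, h, pwt]
    · rw [dif_neg h]
      exact γ.weight_eq_pwt ha hu hΦu hΦw hvt haff hα h (γ.ite_spec hvt h)

end Observable

namespace HV

/-! ### Expanding the contribution `c(γ)` over the three mid-edges of `v` -/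

/-- The three distinct neighbours of a vertex of `ℍ` are all its neighbours. [folklore] -/
theorem eq_or_eq_or_eq_of_adj {v p q r x : HV} (hp : hvGraph.Adj v p) (hq : hvGraph.Adj v q)
    (hr : hvGraph.Adj v r) (hpq : p ≠ q) (hqr : q ≠ r) (hpr : p ≠ r) (hx : hvGraph.Adj v x) :
    x = p ∨ x = q ∨ x = r := by
  rcases adj_cases hp hx with h | h | h
  · exact Or.inl h
  · rcases adj_cases hp hq with h' | h' | h'
    · exact absurd h'.symm hpq
    · exact Or.inr (Or.inl (h.trans h'.symm))
    · rcases adj_cases hp hr with h'' | h'' | h''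
      · exact absurd h''.symm hpr
      · exact Or.inr (Or.inr (h.trans h''.symm))
      · exact absurd (h'.trans h''.symm) hqr
  · rcases adj_cases hp hq with h' | h' | h'
    · exact absurd h'.symm hpq
    · rcases adj_cases hp hr with h'' | h'' | h''
      · exact absurd h''.symm hpr
      · exact absurd (h'.trans h''.symm) hqr
      · exact Or.inr (Or.inr (h.trans h''.symm))
    · exact Or.inr (Or.inl (h.trans h'.symm))

/-- **The contribution `c(γ)` of a walk to the vertex relation at `v`, expanded over the three
mid-edges `{v, p}`, `{v, q}`, `{v, r}`**: it is `(direction of the mid-edge) × (weight)` if the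
final dart of `γ` lies on that edge, and `0` otherwise. [cite: DuminilCopinSmirnov2012, proof of
Lemma 1 ("c(γ)")] -/
theorem cv_eq_three {V : Finset HV} {P : List HV} (hP : IsMidWalk V P) {v p q r : HV}
    (hp : hvGraph.Adj v p) (hq : hvGraph.Adj v q) (hr : hvGraph.Adj v r) (hpq : p ≠ q)
    (hqr : q ≠ r) (hpr : p ≠ r) :
    cv v P =
      (if finalDart P = (v, p) ∨ finalDart P = (p, v) then edir v p * pwt P else 0) +
        (if finalDart P = (v, q) ∨ finalDart P = (q, v) then edir v q * pwt P else 0) +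
          (if finalDart P = (v, r) ∨ finalDart P = (r, v) then edir v r * pwt P else 0) := by
  have hadj := hP.adj_finalDart
  rw [cv]
  rcases hfd : finalDart P with ⟨d₁, d₂⟩
  rw [hfd] at hadj
  simp only at hadj
  have hvp := hp.ne
  have hvq := hq.ne
  have hvr := hr.ne
  by_cases h1 : d₁ = v
  · subst h1
    rcases eq_or_eq_or_eq_of_adj hp hq hr hpq hqr hpr hadj with rfl | rfl | rfl
    · simp [hvp.symm, hpq, hpr, hvq, hvr]
    · simp [hvq.symm, hpq.symm, hqr, hvp, hvr]
    · simp [hvr.symm, hpr.symm, hqr.symm, hvp, hvq]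
  · by_cases h2 : d₂ = v
    · subst h2
      rcases eq_or_eq_or_eq_of_adj hp hq hr hpq hqr hpr hadj.symm with rfl | rfl | rfl
      · simp [hvp.symm, hpq, hpr, hvq, hvr]
      · simp [hvq.symm, hpq.symm, hqr, hvp, hvr]
      · simp [hvr.symm, hpr.symm, hqr.symm, hvp, hvq]
    · simp [h1, h2]

/-! ### Simply connected domains: the entrance is outside every loop -/

/-- The faces to the left of the darts leaving an up vertex `(a, b, 0)` have first coordinate
`a` or `a + 1`. [folklore] -/
theorem leftFace_fst_of_adj {a b : ℤ} {g : HV} (h : hvGraph.Adj (a, b, false) g) :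
    (leftFace (a, b, false) g).1 = a ∨ (leftFace (a, b, false) g).1 = a + 1 := by
  obtain ⟨x, y, z⟩ := g
  cases z <;> simp only [hvGraph_adj, AdjRel] at h <;> simp at h
  rcases h with ⟨rfl, rfl⟩ | ⟨rfl, rfl⟩ | ⟨rfl, rfl⟩ <;> simp

variable {Λ : Finset HexVertex} {u : HexVertex} {Φ : hexGraph ≃g hvGraph}

/-- **"`a ∈ ∂Ω`, `Ω` simply connected" in winding numbers**: if the complement of `Λ` is
connected in `ℍ` and the entrance mid-edge `a = {u, w₁}` has `u ∉ Λ`, then every simple cycle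
of `Φ(Λ)` has winding number `0` around the face `(1, 0)` at the entrance dart: `u` is joined
to a far away vertex by a lattice path avoiding `Λ`, along which the winding number is
constant (`wnd_rightFace_pdarts_eq`), and it vanishes far away. [cite: DuminilCopinSmirnov2012,
§2 ("we further assume Ω to be simply connected, i.e. having a connected complement") and
proof of Lemma 1] -/
theorem wnd_eq_zero_of_simplyConnected (hΛ : hexDomainSimplyConnected Λ) (hu : u ∉ Λ)
    (hΦu : Φ u = wOut) (c : List HV) (hc : ∀ x ∈ c, x ∈ Λ.map Φ.toEquiv.toEmbedding)
    (hcyc : IsCyc c) : wnd c (1, 0) = 0 := by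
  classical
  set V := Λ.map Φ.toEquiv.toEmbedding with hV
  -- a bound on the first coordinates of `V`
  obtain ⟨N, hN⟩ := Finset.exists_le (V.image fun x : HV => x.1)
  have hN' : ∀ x ∈ V, x.1 ≤ N := fun x hx => hN _ (Finset.mem_image_of_mem _ hx)
  -- a far vertex outside `Λ`
  set y' : HV := (N + 1, 0, false) with hy'
  set y₀ : HexVertex := Φ.symm y' with hy₀
  have hyy : Φ y₀ = y' := RelIso.apply_symm_apply Φ y'
  have hy₀Λ : y₀ ∉ Λ := fun h => by
    have := hN' (Φ y₀) (Finset.mem_map_of_mem _ h)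
    rw [hyy, hy'] at this
    simp at this
  -- a lattice path from `u` to `y₀` avoiding `Λ`
  obtain ⟨W⟩ := hΛ ⟨u, by simpa using hu⟩ ⟨y₀, by simpa using hy₀Λ⟩
  set Q : List HV := W.support.map fun x => Φ x.1 with hQ
  have hQc : Q.IsChain hvGraph.Adj := by
    rw [hQ, List.isChain_map]
    exact List.IsChain.imp (fun x y h => (Φ.map_rel_iff).2 h) W.isChain_adj_support
  have hQV : ∀ x ∈ Q, x ∉ V := by
    intro x hx hxV
    obtain ⟨z, -, rfl⟩ := List.mem_map.1 hx
    obtain ⟨z', hz', hzz⟩ := Finset.mem_map.1 hxV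
    change Φ z' = Φ z.1 at hzz
    exact z.2 (Φ.injective hzz ▸ hz')
  have hQne : Q ≠ [] := by simp [hQ]
  have hQlast : Q.getLast hQne = y' := by
    rw [← hyy]
    simp [hQ, List.getLast_map, W.getLast_support]
  obtain ⟨Qt, hQt⟩ : ∃ Qt, Q = wOut :: Qt := by
    refine ⟨W.support.tail.map fun x => Φ x.1, ?_⟩
    have e := congrArg (List.map fun x => Φ x.1) W.cons_tail_support
    simp only [List.map_cons] at e
    rw [hQ, ← e, hΦu]
  obtain ⟨Q₀, hQ₀⟩ : ∃ Q₀, Q = Q₀ ++ [y'] :=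
    ⟨Q.dropLast, by rw [← hQlast, List.dropLast_append_getLast]⟩
  -- propagate the winding number along `hvOrigin :: Q`
  have hpath : (hvOrigin :: Q).IsChain hvGraph.Adj := by
    rw [hQt] at hQc ⊢
    exact List.IsChain.cons_cons adj_wOut_hvOrigin.symm hQc
  have hint : ∀ x ∈ (hvOrigin :: Q).tail.dropLast, x ∉ c := fun x hx hxc =>
    hQV x ((List.dropLast_sublist Q).subset hx) (hc x hxc)
  have hd₁ : (hvOrigin, wOut) ∈ pdarts (hvOrigin :: Q) := by
    rw [hQt, pdarts_cons_cons]; exact List.mem_cons_self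
  have hd₂ : ((hvOrigin :: Q₀).getLast (List.cons_ne_nil _ _), y') ∈ pdarts (hvOrigin :: Q) := by
    rw [hQ₀, ← List.cons_append, pdarts_append_singleton _ (List.cons_ne_nil _ _)]
    exact List.mem_append_right _ (List.mem_singleton_self _)
  have key := wnd_rightFace_pdarts_eq hcyc.2.2 _ hpath hint _ hd₁ _ hd₂
  -- the face to the right of the last dart is beyond `V`
  have hg : hvGraph.Adj ((hvOrigin :: Q₀).getLast (List.cons_ne_nil _ _)) y' :=
    adj_of_mem_pdarts hpath _ hd₂
  have hfar : wnd c (rightFace ((hvOrigin :: Q₀).getLast (List.cons_ne_nil _ _)) y') = 0 := by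
    refine wnd_eq_zero_of_fst_ne fun w hw => ?_
    have hw1 := hN' w (hc w hw)
    rcases leftFace_fst_of_adj hg.symm with h | h <;> rw [rightFace, h] <;> omega
  simp only [hfar] at key
  -- the two faces at the entrance edge agree (`wOut ∉ c`)
  have hwc : wOut ∉ c := fun h => hQV wOut (by rw [hQt]; exact List.mem_cons_self) (hc _ h)
  have hlr := wnd_faces_at_eq hcyc.2.2 hwc adj_wOut_hvOrigin adj_wOut_hvOrigin
  rw [show ((1 : ℤ), (0 : ℤ)) = rightFace wOut hvOrigin by decide, ← hlr]
  exact key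

end HV

/-! ### Lemma 1 -/

open HV in
/-- **Duminil-Copin–Smirnov 2012, Lemma 1** (discharge of the named fact
`DuminilCopinSmirnov2012_lemma1`): for a simply connected domain `Ω` of the hexagonal lattice
with vertex set `Λ`, a boundary mid-edge `a ∈ ∂Ω`, and every vertex `v ∈ V(Ω)` with mid-edges
`p, q, r`, the parafermionic observable at `x = x_c = 1/√(2+√2)`, `σ = 5/8` satisfies
`(p - v)F(p) + (q - v)F(q) + (r - v)F(r) = 0`. Proof: a chart `Φ : hexGraph ≃g hvGraph`
(a similarity of the embedded lattices) takes `a` to the standard entrance of the coordinate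
model, where the relation is `HV.vertex_relation_of_wnd` (pairs and triplets of walks, DCS's
proof); simple connectivity makes the entrance lie outside every loop
(`HV.wnd_eq_zero_of_simplyConnected`), the coding of walks is a weight-preserving bijection
(`hexParafermionicObservable_eq_sum_pwt`: geometric winding `= (π/3)·pturn`), and the directions
of the mid-edges transform by the similarity ratio. [cite: DuminilCopinSmirnov2012, Lemma 1] -/
theorem DuminilCopinSmirnov2012_lemma1_holds : DuminilCopinSmirnov2012_lemma1 := by
  intro Λ hΛ a ha v hv p q r hp hq hr hpq hqr hpr
  obtain ⟨haE, u, w₁, rfl, hw₁, hu⟩ := ha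
  have huw : hexGraph.Adj u w₁ := (SimpleGraph.mem_edgeSet hexGraph).1 haE
  obtain ⟨Φ, α, β, hα, hΦu, hΦw, haff⟩ := exists_chart huw
  set V := Λ.map Φ.toEquiv.toEmbedding with hV
  have hw : wOut ∉ V := by
    intro h
    obtain ⟨y, hy, hyu⟩ := Finset.mem_map.1 h
    change Φ y = wOut at hyu
    exact hu (Φ.injective (hyu.trans hΦu.symm) ▸ hy)
  have hvV : Φ v ∈ V := Finset.mem_map_of_mem _ hv
  have key := vertex_relation_of_wnd hw
    (fun c hc hcyc => wnd_eq_zero_of_simplyConnected hΛ hu hΦu c hc hcyc) hvV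
  -- expand the contributions over the three mid-edges
  have hp' : hvGraph.Adj (Φ v) (Φ p) := (Φ.map_rel_iff).2 hp
  have hq' : hvGraph.Adj (Φ v) (Φ q) := (Φ.map_rel_iff).2 hq
  have hr' : hvGraph.Adj (Φ v) (Φ r) := (Φ.map_rel_iff).2 hr
  rw [Finset.sum_congr rfl fun P hP => cv_eq_three (mem_midWalks_iff.1 hP) hp' hq' hr'
    (Φ.injective.ne hpq) (Φ.injective.ne hqr) (Φ.injective.ne hpr),
    Finset.sum_add_distrib, Finset.sum_add_distrib] at key
  have ht : ∀ t, hexGraph.Adj v t →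
      ∑ P ∈ midWalks V, (if finalDart P = (Φ v, Φ t) ∨ finalDart P = (Φ t, Φ v)
        then edir (Φ v) (Φ t) * pwt P else 0) =
      (2 * α) * (hexMidpoint s(v, t) - hexCenter v) *
        hexParafermionicObservable Λ s(u, w₁) hexCriticalFugacity (5 / 8) s(v, t) := by
    intro t hvt
    rw [← Finset.sum_filter, ← Finset.mul_sum,
      ← hexParafermionicObservable_eq_sum_pwt rfl hu hw₁ huw hΦu hΦw haff hα hvt hv, edir,
      emb_sub, haff, haff, hexMidpoint_mk]
    ring
  rw [ht p hp, ht q hq, ht r hr] at key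
  rw [show (Real.sqrt (2 + Real.sqrt 2))⁻¹ = hexCriticalFugacity from rfl]
  have h2α : (2 : ℂ) * α ≠ 0 := mul_ne_zero two_ne_zero hα
  refine mul_left_cancel₀ h2α ?_
  rw [mul_zero]
  linear_combination key





end Literature.Probability.RandomPlanarGeometry.SAW
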